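import Summits.AtomisticToContinuum.BoseEinsteinCondensation.Theorems.BECDyadicChainingCoherentAmplitudeMonotone
import Literature.MathematicalPhysics.QuantumManyBody.DiluteBoseGasUpperBoundLocalization
import Literature.MathematicalPhysics.QuantumManyBody.BoseGasThermodynamicLimitRuelle

/-!
# Route `BECDyadicChaining`, crux `BaseCoherentMass` — helpers for the composition

Support lemmas for the closing file of crux stmt-AtomisticToContinuum-13193 (line `registered`, lead):

* `kineticBudget` — the kinetic budget E of the line, interacting case: for `a(v) > 0` and every
  `ε > 0`, at small density, eventually in `N`, `E₀(N, (N/ρ)^{1/3}) ≤ ε ρ^{2/3} N` (Dyson's upper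
  bound `eventually_groundStateEnergy_le_dyson`).
* `energy_eq_energy_zero`, `groundStateEnergy_eq_zero_pot` — the free reduction: if `v(|x|) = 0`
  a.e. then Dirichlet energies and ground-state energies are the free ones.
* `exists_level`, `occupation_openMode_eq` — bookkeeping (a dyadic
  level in a bracket, open cubes versus half-open cells).
* `sqrt_le_two_coherentAmplitude_of_ledger` — the TRUNCATED TANGENT-LINE HÖLDER step: from
  `n ≤ m + o`, `Σ n ≥ (199/200)N`, `Σ m² ≤ (15/4)N²/8^K`, `Σ o ≤ N/200` to `√N ≤ 2·8^{-K/2} Σ √n`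
  (`a n' ≤ √n' + (4a³/27) n'²` on `n' = min(n, m)`, `4p³ - 27p + 27 = (p+3)(2p-3)²`).

References: [LSSY2005] Thm. 2.2, App. C; [Dyson1957].
-/

noncomputable section

namespace Summit.AtomisticToContinuum.BoseEinsteinCondensation.Theorems.BaseCoherentMass

open scoped BigOperators ENNReal ComplexConjugate
open Filter MeasureTheory
open Literature.MathematicalPhysics.QuantumManyBody.BoseGas

/-! ### The kinetic budget (`a > 0`) and the free reduction (`a = 0`) -/

/-- **Kinetic budget (E), interacting case.** For repulsive finite-range `v` with `a > 0` and every
`ε > 0`: at all small densities, eventually in `N`, `E₀(N, (N/ρ)^{1/3}) ≤ ε ρ^{2/3} N` — Dyson's upper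
bound `4πρa(1 + C(ρa³)^{1/3})N` and `4πρa = 4πa ρ^{1/3} · ρ^{2/3}`. [cite: LSSY2005, Thm. 2.2 (2.14)–(2.15); Dyson1957] -/
theorem kineticBudget {v : ℝ → ℝ≥0∞} (hv : IsRepulsiveFiniteRange v) (ha : 0 < scatteringLength v)
    {ε : ℝ} (hε : 0 < ε) :
    ∃ ρ₀ : ℝ, 0 < ρ₀ ∧ ∀ ρ : ℝ, 0 < ρ → ρ < ρ₀ → ∀ᶠ N : ℕ in Filter.atTop,
      groundStateEnergy v N (sideLength ρ N) ≤ ENNReal.ofReal (ε * ρ ^ (2 / 3 : ℝ) * N) := by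
  obtain ⟨hvm, R₀, hR₀⟩ := hv
  have haT : scatteringLength v ≠ ⊤ := IsRepulsiveFiniteRange.scatteringLength_ne_top ⟨hvm, R₀, hR₀⟩
  obtain ⟨C, ρ₁, hC, hρ₁, H⟩ := eventually_groundStateEnergy_le_dyson hR₀ hvm haT ha
  set a : ℝ := (scatteringLength v).toReal with ha_def
  have ha0 : 0 < a := ENNReal.toReal_pos ha.ne' haT
  set t : ℝ := ε / (4 * Real.pi * a * (1 + C)) with ht
  have ht0 : 0 < t := by positivity
  refine ⟨min ρ₁ (min (a ^ 3)⁻¹ (t ^ 3)), lt_min hρ₁ (lt_min (by positivity) (by positivity)), ?_⟩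
  intro ρ hρ hρlt
  have hρ₁' : ρ < ρ₁ := hρlt.trans_le (min_le_left _ _)
  have hρa : ρ < (a ^ 3)⁻¹ := hρlt.trans_le ((min_le_right _ _).trans (min_le_left _ _))
  have hρt : ρ < t ^ 3 := hρlt.trans_le ((min_le_right _ _).trans (min_le_right _ _))
  filter_upwards [H ρ hρ hρ₁'] with N hN
  refine hN.trans (ENNReal.ofReal_le_ofReal ?_)
  -- `4πρa(1 + C (ρa³)^{1/3}) ≤ ε ρ^{2/3}`
  have hY1 : (ρ * a ^ 3) ^ ((1 : ℝ) / 3) ≤ 1 := by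
    refine Real.rpow_le_one (by positivity) ?_ (by norm_num)
    have : ρ * a ^ 3 < (a ^ 3)⁻¹ * a ^ 3 := mul_lt_mul_of_pos_right hρa (by positivity)
    rw [inv_mul_cancel₀ (by positivity)] at this
    exact this.le
  have hρ13 : ρ ^ ((1 : ℝ) / 3) ≤ t := by
    have h1 : ρ ^ ((1 : ℝ) / 3) ≤ (t ^ 3) ^ ((1 : ℝ) / 3) :=
      Real.rpow_le_rpow hρ.le hρt.le (by norm_num)
    rwa [← Real.rpow_natCast, ← Real.rpow_mul ht0.le, show ((3 : ℕ) : ℝ) * (1 / 3) = 1 by norm_num,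
      Real.rpow_one] at h1
  have hsplit : ρ = ρ ^ ((1 : ℝ) / 3) * ρ ^ ((2 : ℝ) / 3) := by
    rw [← Real.rpow_add hρ]; norm_num
  have hN0 : (0 : ℝ) ≤ N := Nat.cast_nonneg N
  have hρ23 : 0 ≤ ρ ^ ((2 : ℝ) / 3) := Real.rpow_nonneg hρ.le _
  have key : 4 * Real.pi * ρ * a * (1 + C * (ρ * a ^ 3) ^ ((1 : ℝ) / 3)) ≤ ε * ρ ^ ((2 : ℝ) / 3) := by
    have h1 : 1 + C * (ρ * a ^ 3) ^ ((1 : ℝ) / 3) ≤ 1 + C := by nlinarith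
    have h2 : 4 * Real.pi * a * (1 + C) * t = ε := by
      rw [ht]; field_simp
    calc 4 * Real.pi * ρ * a * (1 + C * (ρ * a ^ 3) ^ ((1 : ℝ) / 3))
        ≤ 4 * Real.pi * ρ * a * (1 + C) := by gcongr
      _ = 4 * Real.pi * a * (1 + C) * ρ ^ ((1 : ℝ) / 3) * ρ ^ ((2 : ℝ) / 3) := by
          conv_lhs => rw [hsplit]
          ring
      _ ≤ 4 * Real.pi * a * (1 + C) * t * ρ ^ ((2 : ℝ) / 3) := by gcongr
      _ = ε * ρ ^ ((2 : ℝ) / 3) := by rw [h2]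
  calc 4 * Real.pi * ρ * (scatteringLength v).toReal *
        (1 + C * (ρ * (scatteringLength v).toReal ^ 3) ^ ((1 : ℝ) / 3)) * N
      = 4 * Real.pi * ρ * a * (1 + C * (ρ * a ^ 3) ^ ((1 : ℝ) / 3)) * N := by rw [ha_def]
    _ ≤ ε * ρ ^ ((2 : ℝ) / 3) * N := mul_le_mul_of_nonneg_right key hN0
    _ = ε * ρ ^ (2 / 3 : ℝ) * N := by norm_num

/-- If `v(|x|) = 0` for a.e. `x ∈ ℝ³`, then for `i ≠ j` also `v(|xᵢ - xⱼ|) = 0` for a.e. configuration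
(the pair-difference map is a surjective linear map, `ae_comp_linearMap_mem_iff`). [folklore] -/
theorem ae_pairPotential_eq_zero {v : ℝ → ℝ≥0∞} (hv : Measurable v) (hv0 : ∀ᵐ x : Space, v ‖x‖ = 0)
    {N : ℕ} {i j : Fin N} (hij : i ≠ j) : ∀ᵐ X : Config N, v (dist (X i) (X j)) = 0 := by
  have hs : MeasurableSet {y : Space | v ‖y‖ = 0} :=
    hv.comp measurable_norm (measurableSet_singleton 0)
  let T : Config N →ₗ[ℝ] Space :=
    LinearMap.proj (R := ℝ) (φ := fun _ : Fin N => Space) i -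
      LinearMap.proj (R := ℝ) (φ := fun _ : Fin N => Space) j
  have hT : Function.Surjective T := fun y =>
    ⟨Pi.single i y, by simp [T, Pi.single_eq_of_ne hij.symm]⟩
  have h := (ae_comp_linearMap_mem_iff T volume volume hT hs).2 hv0
  filter_upwards [h] with X hX
  simpa [T, dist_eq_norm] using hX

/-- **Free reduction.** If `v(|x|) = 0` a.e. then every Dirichlet energy is the free one:
`energy v Ψ = energy 0 Ψ` (the interaction vanishes for a.e. configuration). [folklore] -/
theorem energy_eq_energy_zero {v : ℝ → ℝ≥0∞} (hv : Measurable v) (hv0 : ∀ᵐ x : Space, v ‖x‖ = 0)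
    {N : ℕ} {L : ℝ} (Ψ : TrialState N L) : energy v Ψ = energy 0 Ψ := by
  have hint : ∀ᵐ X : Config N, interaction v X = 0 := by
    have h : ∀ᵐ X : Config N, ∀ i j : Fin N, i ≠ j → v (dist (X i) (X j)) = 0 := by
      refine ae_all_iff.2 fun i => ae_all_iff.2 fun j => ?_
      by_cases hij : i = j
      · exact Filter.Eventually.of_forall fun X h => absurd hij h
      · exact (ae_pairPotential_eq_zero hv hv0 hij).mono fun X hX _ => hX
    refine h.mono fun X hX => ?_
    refine Finset.sum_eq_zero fun i _ => Finset.sum_eq_zero fun j hj => ?_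
    exact hX i j (Finset.mem_filter.1 hj).2.ne
  unfold energy
  refine lintegral_congr_ae ?_
  filter_upwards [hint] with X hX
  have h0 : interaction 0 X = 0 := by simp [interaction]
  rw [hX, h0]

/-- With `v(|x|) = 0` a.e. the Dirichlet ground-state energy is the free one. [folklore] -/
theorem groundStateEnergy_eq_zero_pot {v : ℝ → ℝ≥0∞} (hv : Measurable v)
    (hv0 : ∀ᵐ x : Space, v ‖x‖ = 0) (N : ℕ) (L : ℝ) :
    groundStateEnergy v N L = groundStateEnergy 0 N L :=
  iInf_congr fun Ψ => energy_eq_energy_zero hv hv0 Ψ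

/-! ### Bookkeeping for the composition -/

/-- A dyadic level in the bracket `[ℓ_b, 2ℓ_b)` exists once `L ≥ ℓ_b > 0`. [folklore] -/
theorem exists_level {ℓb L : ℝ} (hℓb : 0 < ℓb) (hL : ℓb ≤ L) :
    ∃ K : ℕ, ℓb ≤ L / 2 ^ K ∧ L / 2 ^ K < 2 * ℓb := by
  have hx : 1 ≤ L / ℓb := by rw [le_div_iff₀ hℓb, one_mul]; exact hL
  obtain ⟨K, h1, h2⟩ := exists_nat_pow_near hx one_lt_two
  refine ⟨K, ?_, ?_⟩
  · rw [le_div_iff₀ (pow_pos two_pos K)]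
    have h3 := (le_div_iff₀ hℓb).mp h1
    linarith [mul_comm ℓb ((2 : ℝ) ^ K)]
  · rw [div_lt_iff₀ (pow_pos two_pos K)]
    have h3 := (div_lt_iff₀ hℓb).mp h2
    calc L < 2 ^ (K + 1) * ℓb := h3
      _ = 2 * ℓb * 2 ^ K := by ring

/-- The route's OPEN dyadic cube flat mode has the same occupation as `dyMode` (they agree a.e.).
[folklore] -/
theorem occupation_openMode_eq (N : ℕ) (L : ℝ) (K : ℕ) (i : Fin 3 → Fin (2 ^ K)) (Ψ : Config N → ℂ) :
    occupation N (Set.indicator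
      {x : EuclideanSpace ℝ (Fin 3) | ∀ k : Fin 3, x k ∈ Set.Ioo (((i k : ℕ) : ℝ) * (L / 2 ^ K))
        ((((i k : ℕ) : ℝ) + 1) * (L / 2 ^ K))}
      (fun _ => ((Real.sqrt ((L / 2 ^ K) ^ 3))⁻¹ : ℂ))) Ψ = occupation N (dyMode L K i) Ψ :=
  occupation_congr_ae (indicator_ae_eq_of_ae_eq_set
    (Summit.AtomisticToContinuum.BoseEinsteinCondensation.Theorems.CoherentAmplitudeMonotone.openCell_ae_eq_dyCell
      L K i)) Ψ

/-- **Tangent-line Hölder, truncated.** If `n_i ≤ m_i + o_i` (cells `i` of a level with `8^K` cubes),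
`ofReal(199N/200) ≤ Σ n`, `Σ m² ≤ ofReal((15/4)N²/8^K)` and `Σ o ≤ ofReal(N/200)`, then
`√N ≤ 2 · 8^{-K/2} Σ √n`: run `a n' ≤ √n' + (4a³/27) n'²` on `n' = min(n, m)` with
`a = (3/4)·8^{K/2}/√N` (`Σ n' ≥ 0.99N`, `Σ n'² ≤ Σ m²`) — `297/400 - 15/64 ≥ 1/2`. [folklore] -/
theorem sqrt_le_two_coherentAmplitude_of_ledger : ∀ {ι : Type} [Fintype ι] {N K : ℕ}, 0 < N →
    ∀ (n m o : ι → ℝ≥0∞), (∀ i, n i ≤ m i + o i) →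
    ENNReal.ofReal (199 / 200 * (N : ℝ)) ≤ ∑ i, n i →
    ∑ i, m i ^ 2 ≤ ENNReal.ofReal (15 / 4 * (N : ℝ) ^ 2 / 8 ^ K) →
    ∑ i, o i ≤ ENNReal.ofReal ((N : ℝ) / 200) →
    (N : ℝ≥0∞) ^ (1 / 2 : ℝ) ≤ 2 * ((8 : ℝ≥0∞) ^ (-(K : ℝ) / 2) * ∑ i, (n i) ^ (1 / 2 : ℝ)) := by
  intro ι _ N K hN n m o hle hS1 hm ho
  classical
  -- (0) two elementary inequalities: `a s² ≤ s + (4a³/27) s⁴` on `ℝ≥0`, and its `ℝ≥0∞` form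
  have keyR : ∀ a s : ℝ, 0 ≤ a → 0 ≤ s → a * s ^ 2 ≤ s + 4 * a ^ 3 / 27 * (s ^ 2) ^ 2 := by
    intro a s ha hs
    have h1 : 0 ≤ s * ((a * s + 3) * (2 * (a * s) - 3) ^ 2) := by positivity
    nlinarith [h1]
  have key : ∀ a : ℝ, 0 ≤ a → ∀ x : ℝ≥0∞,
      ENNReal.ofReal a * x ≤ x ^ (1 / 2 : ℝ) + ENNReal.ofReal (4 * a ^ 3 / 27) * x ^ 2 := by
    intro a ha x
    rcases eq_or_ne x ⊤ with hx | hx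
    · rw [hx, ENNReal.top_rpow_of_pos (by norm_num : (0 : ℝ) < 1 / 2), top_add]
      exact le_top
    · have hy0 : 0 ≤ x.toReal := ENNReal.toReal_nonneg
      have hr := keyR a (Real.sqrt x.toReal) ha (Real.sqrt_nonneg _)
      rw [Real.sq_sqrt hy0, Real.sqrt_eq_rpow] at hr
      calc ENNReal.ofReal a * x = ENNReal.ofReal (a * x.toReal) := by
            rw [ENNReal.ofReal_mul ha, ENNReal.ofReal_toReal hx]
        _ ≤ ENNReal.ofReal (x.toReal ^ (1 / 2 : ℝ) + 4 * a ^ 3 / 27 * x.toReal ^ 2) :=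
            ENNReal.ofReal_le_ofReal hr
        _ = x ^ (1 / 2 : ℝ) + ENNReal.ofReal (4 * a ^ 3 / 27) * x ^ 2 := by
            rw [ENNReal.ofReal_add (Real.rpow_nonneg hy0 _) (by positivity),
              ← ENNReal.ofReal_rpow_of_nonneg hy0 (by norm_num : (0 : ℝ) ≤ 1 / 2),
              ENNReal.ofReal_mul (by positivity : (0 : ℝ) ≤ 4 * a ^ 3 / 27),
              ENNReal.ofReal_pow hy0, ENNReal.ofReal_toReal hx]
  -- (1) the truncated occupations
  set n' : ι → ℝ≥0∞ := fun i => min (n i) (m i) with hn'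
  have hn'le : ∀ i, n i ≤ n' i + o i := by
    intro i
    rcases le_total (n i) (m i) with h | h
    · rw [hn']; simp only [min_eq_left h]; exact le_self_add
    · rw [hn']; simp only [min_eq_right h]; exact hle i
  have hS1' : ENNReal.ofReal (99 / 100 * (N : ℝ)) ≤ ∑ i, n' i := by
    have h1 : ∑ i, n i ≤ ∑ i, n' i + ENNReal.ofReal ((N : ℝ) / 200) := by
      calc ∑ i, n i ≤ ∑ i, (n' i + o i) := Finset.sum_le_sum fun i _ => hn'le i
        _ = ∑ i, n' i + ∑ i, o i := Finset.sum_add_distrib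
        _ ≤ ∑ i, n' i + ENNReal.ofReal ((N : ℝ) / 200) := add_le_add le_rfl ho
    have h2 : ENNReal.ofReal (199 / 200 * (N : ℝ)) =
        ENNReal.ofReal (99 / 100 * (N : ℝ)) + ENNReal.ofReal ((N : ℝ) / 200) := by
      rw [← ENNReal.ofReal_add (by positivity) (by positivity)]
      congr 1; ring
    have h3 := hS1.trans h1
    rw [h2] at h3
    exact (ENNReal.add_le_add_iff_right ENNReal.ofReal_ne_top).mp h3
  have hS2' : ∑ i, (n' i) ^ 2 ≤ ENNReal.ofReal (15 / 4 * (N : ℝ) ^ 2 / 8 ^ K) :=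
    (Finset.sum_le_sum fun i _ => pow_le_pow_left' (min_le_right _ _) 2).trans hm
  have hmono : ∑ i, (n' i) ^ (1 / 2 : ℝ) ≤ ∑ i, (n i) ^ (1 / 2 : ℝ) :=
    Finset.sum_le_sum fun i _ => ENNReal.rpow_le_rpow (min_le_left _ _) (by norm_num)
  -- (2) tangent-line Hölder: `a Σn' ≤ Σ√n' + (4a³/27) Σn'²` with `a = (3/4) u/w`, `u = √(8^K)`, `w = √N`
  have hNpos : (0 : ℝ) < N := Nat.cast_pos.mpr hN
  have h8K : (0 : ℝ) < 8 ^ K := pow_pos (by norm_num) K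
  set u : ℝ := Real.sqrt (8 ^ K) with hu
  set w : ℝ := Real.sqrt N with hw
  have hu0 : 0 < u := Real.sqrt_pos.mpr h8K
  have hw0 : 0 < w := Real.sqrt_pos.mpr hNpos
  have hu2 : u ^ 2 = 8 ^ K := Real.sq_sqrt h8K.le
  have hw2 : w ^ 2 = (N : ℝ) := Real.sq_sqrt hNpos.le
  set a : ℝ := 3 / 4 * (u / w) with ha
  have ha0 : 0 ≤ a := by positivity
  have hsum : ENNReal.ofReal a * (∑ i, n' i) ≤
      (∑ i, (n' i) ^ (1 / 2 : ℝ)) + ENNReal.ofReal (4 * a ^ 3 / 27) * ∑ i, (n' i) ^ 2 := by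
    rw [Finset.mul_sum, Finset.mul_sum, ← Finset.sum_add_distrib]
    exact Finset.sum_le_sum fun i _ => key a ha0 (n' i)
  have hB0 : (0 : ℝ) ≤ 4 * a ^ 3 / 27 * (15 / 4 * (N : ℝ) ^ 2 / 8 ^ K) := by positivity
  have hAB : ENNReal.ofReal (a * (99 / 100 * (N : ℝ))) ≤ (∑ i, (n' i) ^ (1 / 2 : ℝ)) +
      ENNReal.ofReal (4 * a ^ 3 / 27 * (15 / 4 * (N : ℝ) ^ 2 / 8 ^ K)) :=
    calc ENNReal.ofReal (a * (99 / 100 * (N : ℝ)))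
        = ENNReal.ofReal a * ENNReal.ofReal (99 / 100 * (N : ℝ)) := ENNReal.ofReal_mul ha0
      _ ≤ ENNReal.ofReal a * ∑ i, n' i := mul_le_mul' le_rfl hS1'
      _ ≤ (∑ i, (n' i) ^ (1 / 2 : ℝ)) + ENNReal.ofReal (4 * a ^ 3 / 27) * ∑ i, (n' i) ^ 2 := hsum
      _ ≤ (∑ i, (n' i) ^ (1 / 2 : ℝ)) +
            ENNReal.ofReal (4 * a ^ 3 / 27) * ENNReal.ofReal (15 / 4 * (N : ℝ) ^ 2 / 8 ^ K) :=
          add_le_add le_rfl (mul_le_mul' le_rfl hS2')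
      _ = (∑ i, (n' i) ^ (1 / 2 : ℝ)) +
            ENNReal.ofReal (4 * a ^ 3 / 27 * (15 / 4 * (N : ℝ) ^ 2 / 8 ^ K)) := by
          rw [(ENNReal.ofReal_mul (by positivity : (0 : ℝ) ≤ 4 * a ^ 3 / 27)).symm]
  have hA : a * (99 / 100 * (N : ℝ)) = 297 / 400 * (u * w) := by
    rw [ha, ← hw2]
    calc 3 / 4 * (u / w) * (99 / 100 * w ^ 2) = 297 / 400 * (u * w) * (w / w) := by ring
      _ = 297 / 400 * (u * w) := by rw [div_self hw0.ne', mul_one]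
  have hB : 4 * a ^ 3 / 27 * (15 / 4 * (N : ℝ) ^ 2 / 8 ^ K) = 15 / 64 * (u * w) := by
    rw [ha, ← hw2, ← hu2]
    calc 4 * (3 / 4 * (u / w)) ^ 3 / 27 * (15 / 4 * (w ^ 2) ^ 2 / u ^ 2)
        = 15 / 64 * (u * w) * ((u / u) ^ 2 * (w / w) ^ 3) := by ring
      _ = 15 / 64 * (u * w) := by rw [div_self hu0.ne', div_self hw0.ne']; ring
  have hT : ENNReal.ofReal (u * w / 2) ≤ ∑ i, (n' i) ^ (1 / 2 : ℝ) := by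
    have h1 : ENNReal.ofReal (a * (99 / 100 * (N : ℝ))) -
        ENNReal.ofReal (4 * a ^ 3 / 27 * (15 / 4 * (N : ℝ) ^ 2 / 8 ^ K)) ≤ ∑ i, (n' i) ^ (1 / 2 : ℝ) :=
      tsub_le_iff_right.mpr hAB
    have h2 : ENNReal.ofReal (a * (99 / 100 * (N : ℝ)) - 4 * a ^ 3 / 27 * (15 / 4 * (N : ℝ) ^ 2 / 8 ^ K)) ≤
        ∑ i, (n' i) ^ (1 / 2 : ℝ) := by
      rw [ENNReal.ofReal_sub _ hB0]; exact h1
    rw [hA, hB] at h2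
    refine (ENNReal.ofReal_le_ofReal ?_).trans h2
    nlinarith [mul_pos hu0 hw0]
  -- (3) conclusion: `√N = w`, `8^{-K/2} = u⁻¹`, and `2 · u⁻¹ · (u w / 2) = w`
  have hN12 : (N : ℝ≥0∞) ^ (1 / 2 : ℝ) = ENNReal.ofReal w := by
    rw [← ENNReal.ofReal_natCast, ENNReal.ofReal_rpow_of_nonneg (Nat.cast_nonneg N)
      (by norm_num : (0 : ℝ) ≤ 1 / 2), hw, Real.sqrt_eq_rpow]
  have h8nn : (0 : ℝ) ≤ 8 := by norm_num
  have h8 : (8 : ℝ≥0∞) ^ (-(K : ℝ) / 2) = ENNReal.ofReal u⁻¹ := by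
    rw [show (8 : ℝ≥0∞) = ENNReal.ofReal 8 by norm_num,
      ENNReal.ofReal_rpow_of_pos (by norm_num : (0 : ℝ) < 8)]
    congr 1
    rw [neg_div, Real.rpow_neg h8nn, show (K : ℝ) / 2 = (K : ℝ) * (1 / 2) by ring, hu,
      Real.sqrt_eq_rpow, ← Real.rpow_natCast, ← Real.rpow_mul h8nn]
  have hre : 2 * (u⁻¹ * (u * w / 2)) = w := by
    rw [show 2 * (u⁻¹ * (u * w / 2)) = (u⁻¹ * u) * w by ring, inv_mul_cancel₀ hu0.ne', one_mul]
  have hfin : ENNReal.ofReal w = 2 * (ENNReal.ofReal u⁻¹ * ENNReal.ofReal (u * w / 2)) := by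
    rw [← ENNReal.ofReal_mul (inv_nonneg.mpr hu0.le), show (2 : ℝ≥0∞) = ENNReal.ofReal 2 by norm_num,
      ← ENNReal.ofReal_mul (by norm_num : (0 : ℝ) ≤ 2), hre]
  rw [hN12, h8, hfin]
  exact mul_le_mul' le_rfl (mul_le_mul' le_rfl (hT.trans hmono))

end Summit.AtomisticToContinuum.BoseEinsteinCondensation.Theorems.BaseCoherentMass

end
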